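import Mathlib
import Literature.RepresentationTheory.FiniteGroups.IrreducibleCharacters
import Literature.RepresentationTheory.FiniteGroups.IsotypicProjector
import Summits.MatrixMultiplication.MatrixMultiplication.Theorems.LevelGradedCohnUmansGradedDesignFamilyStubWreathBudgetIndex

/-!
# Stub `stub_wreathBudget` (line `Sketch`, crux `GradedDesignFamily`), part 2:
# the graded budget of the wreath product `(ι → H) ⋊ Perm ι`

For a finite group `H`, a bi-invariant test space `J_H ≤ ℂ^H`, a finite index type `ι` and a real
exponent `s ≥ 2`, the graded budget `Σᶠ_{χ ∈ Irr W ∩ J_wr} χ(1)^s` of the wreath product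
`W = (ι → H) ⋊[mulAutArrow] Perm ι` with respect to the wreath test space
`J_wr = span{w ↦ [w.right = τ₀] Π_j g_j (w.left j) : g_j ∈ J_H}` is at most `(|ι|!)^{s-1}` times
the graded budget of the base group `N = ι → H` with respect to
`J_H^{⊠ι} = span{k ↦ Π_j g_j (k j) : g_j ∈ J_H}` (`stub_wreathBudget`; the graded form of
Cohn–Kleinberg–Szegedy–Umans 2005, Lemma 7.2).  This is the subgroup-index inequality
`wreathBudget_index_le` of part 1 for `inl : N →* W` (index `|ι|!`), whose transfer hypothesis —
every irreducible constituent of `χ ∘ inl`, `χ ∈ Irr W ∩ J_wr`, lies in `J_H^{⊠ι}` — holds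
because `χ ∘ inl ∈ J_H^{⊠ι}` (`wreathBudget_comp_inl_mem`), `J_H^{⊠ι}` is invariant under right
translations (`wreathBudget_prodSpace_rightInv`), and the constituents of a class function in a
right-invariant space stay in it (`wreathBudget_mem_of_classInner_ne_zero`, via the convolution
identity `Σ_t ψ(t) χ(k t⁻¹) = [χ = ψ] (|N|/ψ(1)) ψ(k)` for irreducible characters,
`wreathBudget_convolution`, i.e. the isotypic projector on an irreducible representation).
-/

noncomputable section

set_option linter.dupNamespace false

open scoped BigOperators
open Literature.RepresentationTheory.FiniteGroups

namespace Summit.MatrixMultiplication.MatrixMultiplication.Theorems.GradedDesignFamily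

/-- **Convolution of irreducible characters** (Serre §2.6 Thm. 8 via the isotypic projector):
for irreducible characters `ψ`, `χ` of the finite group `N` and `k ∈ N`,
`Σ_t ψ(t) χ(k t⁻¹) = [χ = ψ] (|N| / ψ(1)) ψ(k)`; indeed the left side is
`tr (ρ(k) ∘ Σ_t ψ(t) ρ(t⁻¹)) = (|N|/ψ(1)) tr (ρ(k) ∘ P_ψ)` for `χ = χ_ρ`, and `P_ψ = 1` or `0` on
the irreducible `ρ`. [cite: SerreLinearRepresentations1977, §2.6 Thm. 8] -/
theorem wreathBudget_convolution {N : Type} [Group N] [Fintype N] [DecidableEq (N → ℂ)]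
    {ψ χ : N → ℂ} (hψ : IsIrrChar N ψ) (hχ : IsIrrChar N χ) (k : N) :
    ∑ t : N, ψ t * χ (k * t⁻¹) = if χ = ψ then (Fintype.card N : ℂ) / ψ 1 * ψ k else 0 := by
  obtain ⟨V, _, _, _, ρ, hρ, rfl⟩ := hχ
  haveI := hρ
  have hψ1 : ψ 1 ≠ 0 := by
    obtain ⟨d, hd, h1⟩ := wreathBudget_exists_deg hψ
    rw [hd]
    exact_mod_cast (by omega : d ≠ 0)
  have hcard : (Fintype.card N : ℂ) ≠ 0 := Nat.cast_ne_zero.mpr Fintype.card_ne_zero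
  -- `Σ_t ψ(t) χ_ρ(k t⁻¹) = tr (ρ(k) ∘ ρ_ψ)`
  have hsum : ∑ t : N, ψ t * ρ.character (k * t⁻¹) =
      LinearMap.trace ℂ V (ρ k * Representation.weightedSum ρ ψ) := by
    rw [Representation.weightedSum, Finset.mul_sum, map_sum]
    refine Finset.sum_congr rfl fun t _ => ?_
    rw [mul_smul_comm, map_smul, smul_eq_mul, Representation.character, map_mul]
  -- `ρ_ψ = (|N| / ψ(1)) P_ψ`
  have hws : Representation.weightedSum ρ ψ =
      ((Fintype.card N : ℂ) / ψ 1) • isotypicProj ρ ψ := by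
    rw [isotypicProj, Representation.weightedSum, Representation.weightedSum, Finset.smul_sum]
    refine Finset.sum_congr rfl fun t _ => ?_
    rw [smul_smul, Pi.smul_apply, smul_eq_mul]
    congr 1
    field_simp
  rw [hsum, hws, mul_smul_comm, map_smul, smul_eq_mul]
  by_cases h : ρ.character = ψ
  · rw [isotypicProj_eq_id_of_character_eq ρ h, ← Module.End.one_eq_id, mul_one, if_pos h]
    congr 1
    rw [← h]
    rfl
  · rw [isotypicProj_eq_zero_of_character_ne ρ hψ h, mul_zero, map_zero, mul_zero, if_neg h]

/-- **Constituents stay in a right-invariant space.**  If `J ≤ ℂ^N` is closed under right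
translations, `f ∈ J` is a class function and the irreducible character `ψ` has `⟨f, ψ⟩ ≠ 0`,
then `ψ ∈ J`: the combination of translates `k ↦ Σ_t ψ(t) f(k t⁻¹)` lies in `J` and equals
`⟨f, ψ⟩ (|N|/ψ(1)) ψ` by the Fourier expansion of `f` and `wreathBudget_convolution`. [folklore] -/
theorem wreathBudget_mem_of_classInner_ne_zero {N : Type} [Group N] [Fintype N]
    (J : Submodule ℂ (N → ℂ)) (hJ : ∀ f ∈ J, ∀ c : N, (fun n => f (n * c)) ∈ J)
    {f ψ : N → ℂ} (hf : f ∈ J) (hcl : IsClassFun f) (hψ : IsIrrChar N ψ)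
    (hne : classInner f ψ ≠ 0) : ψ ∈ J := by
  classical
  have hψ1 : ψ 1 ≠ 0 := by
    obtain ⟨d, hd, h1⟩ := wreathBudget_exists_deg hψ
    rw [hd]
    exact_mod_cast (by omega : d ≠ 0)
  have hcard : (Fintype.card N : ℂ) ≠ 0 := Nat.cast_ne_zero.mpr Fintype.card_ne_zero
  set IN := (irrChars_finite_holds N).toFinset with hIN
  -- the combination of right translates
  have hP : (fun k => ∑ t : N, ψ t * f (k * t⁻¹)) ∈ J := by
    have e : (fun k => ∑ t : N, ψ t * f (k * t⁻¹)) = ∑ t : N, ψ t • (fun k => f (k * t⁻¹)) := by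
      funext k
      simp only [Finset.sum_apply, Pi.smul_apply, smul_eq_mul]
    rw [e]
    exact Submodule.sum_mem _ fun t _ => Submodule.smul_mem _ _ (hJ f hf t⁻¹)
  -- it is a non-zero multiple of `ψ`
  have hft : ∀ x : N, f x = ∑ χ ∈ IN, classInner f χ * χ x := by
    intro x
    conv_lhs => rw [hcl.eq_sum_classInner_smul]
    simp only [Finset.sum_apply, Pi.smul_apply, smul_eq_mul, hIN]
  have hPeq : (fun k => ∑ t : N, ψ t * f (k * t⁻¹)) =
      (classInner f ψ * ((Fintype.card N : ℂ) / ψ 1)) • ψ := by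
    funext k
    rw [Pi.smul_apply, smul_eq_mul]
    calc ∑ t : N, ψ t * f (k * t⁻¹)
        = ∑ t : N, ∑ χ ∈ IN, classInner f χ * (ψ t * χ (k * t⁻¹)) := by
          refine Finset.sum_congr rfl fun t _ => ?_
          rw [hft (k * t⁻¹), Finset.mul_sum]
          refine Finset.sum_congr rfl fun χ _ => ?_
          ring
      _ = ∑ χ ∈ IN, classInner f χ * ∑ t : N, ψ t * χ (k * t⁻¹) := by
          rw [Finset.sum_comm]
          refine Finset.sum_congr rfl fun χ _ => ?_
          rw [Finset.mul_sum]
      _ = ∑ χ ∈ IN, (if χ = ψ then classInner f χ * ((Fintype.card N : ℂ) / ψ 1 * ψ k) else 0) := by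
          refine Finset.sum_congr rfl fun χ hχ => ?_
          rw [wreathBudget_convolution hψ ((irrChars_finite_holds N).mem_toFinset.mp hχ) k, mul_ite,
            mul_zero]
      _ = classInner f ψ * ((Fintype.card N : ℂ) / ψ 1 * ψ k) := by
          rw [Finset.sum_ite_eq', if_pos ((irrChars_finite_holds N).mem_toFinset.mpr hψ)]
      _ = classInner f ψ * ((Fintype.card N : ℂ) / ψ 1) * ψ k := by ring
  have hc : classInner f ψ * ((Fintype.card N : ℂ) / ψ 1) ≠ 0 :=
    mul_ne_zero hne (div_ne_zero hcard hψ1)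
  have hψeq : ψ = (classInner f ψ * ((Fintype.card N : ℂ) / ψ 1))⁻¹ •
      (fun k => ∑ t : N, ψ t * f (k * t⁻¹)) := by
    rw [hPeq, smul_smul, inv_mul_cancel₀ hc, one_smul]
  rw [hψeq]
  exact Submodule.smul_mem _ _ hP

/-- **Restriction of the wreath test space to the base group.**  Restricting a function of
`J_wr = span{w ↦ [w.right = τ₀] Π_j g_j (w.left j)}` along `inl : (ι → H) → (ι → H) ⋊ Perm ι`
lands in `J_H^{⊠ι} = span{k ↦ Π_j g_j (k j)}` (a generator restricts to a generator or to `0`).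
[cite: CohnKleinbergSzegedyUmans2005, Thm. 7.1] -/
theorem wreathBudget_comp_inl_mem {H : Type} [Group H] {ι : Type} [Fintype ι] [DecidableEq ι]
    (JH : Submodule ℂ (H → ℂ)) {F : ((ι → H) ⋊[mulAutArrow] Equiv.Perm ι) → ℂ}
    (hF : F ∈ Submodule.span ℂ {F : ((ι → H) ⋊[mulAutArrow] Equiv.Perm ι) → ℂ |
      ∃ (τ₀ : Equiv.Perm ι) (g : ι → (H → ℂ)), (∀ j, g j ∈ JH) ∧
        F = fun w => if w.right = τ₀ then ∏ j, g j (w.left j) else 0}) :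
    (fun n : ι → H => F (SemidirectProduct.inl n)) ∈
      Submodule.span ℂ {F : (ι → H) → ℂ | ∃ g : ι → (H → ℂ),
        (∀ k, g k ∈ JH) ∧ F = fun h => ∏ k, g k (h k)} := by
  have key : ∀ F' : ((ι → H) ⋊[mulAutArrow] Equiv.Perm ι) → ℂ,
      (fun n : ι → H => F' (SemidirectProduct.inl n)) =
        LinearMap.funLeft ℂ ℂ
          (SemidirectProduct.inl : (ι → H) → (ι → H) ⋊[mulAutArrow] Equiv.Perm ι) F' :=
    fun _ => rfl
  rw [key]
  refine (Submodule.map_span_le _ _ _).mpr ?_ (Submodule.mem_map_of_mem hF)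
  rintro _ ⟨τ₀, g, hg, rfl⟩
  rw [← key]
  simp only [SemidirectProduct.right_inl, SemidirectProduct.left_inl]
  by_cases hτ : (1 : Equiv.Perm ι) = τ₀
  · simp only [if_pos hτ]
    exact Submodule.subset_span ⟨g, hg, rfl⟩
  · simp only [if_neg hτ]
    exact Submodule.zero_mem _

/-- **`J_H^{⊠ι}` is invariant under right translations** (because `J_H` is): the translate of a
generator `k ↦ Π_j g_j (k j)` by `c` is the generator with `g'_j = g_j(· c_j)`. [folklore] -/
theorem wreathBudget_prodSpace_rightInv {H : Type} [Group H] {ι : Type} [Fintype ι]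
    (JH : Submodule ℂ (H → ℂ)) (hJH : ∀ f ∈ JH, ∀ a b : H, (fun g : H => f (a * g * b)) ∈ JH)
    {F : (ι → H) → ℂ}
    (hF : F ∈ Submodule.span ℂ {F : (ι → H) → ℂ | ∃ g : ι → (H → ℂ),
      (∀ k, g k ∈ JH) ∧ F = fun h => ∏ k, g k (h k)}) (c : ι → H) :
    (fun n : ι → H => F (n * c)) ∈ Submodule.span ℂ {F : (ι → H) → ℂ | ∃ g : ι → (H → ℂ),
      (∀ k, g k ∈ JH) ∧ F = fun h => ∏ k, g k (h k)} := by
  have key : ∀ F' : (ι → H) → ℂ, (fun n : ι → H => F' (n * c)) =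
      LinearMap.funLeft ℂ ℂ (fun n : ι → H => n * c) F' := fun _ => rfl
  rw [key]
  refine (Submodule.map_span_le _ _ _).mpr ?_ (Submodule.mem_map_of_mem hF)
  rintro _ ⟨g, hg, rfl⟩
  refine Submodule.subset_span ⟨fun k x => g k (x * c k), fun k => ?_, ?_⟩
  · simpa only [one_mul] using hJH (g k) (hg k) 1 (c k)
  · funext n
    rfl

/-- **Stub 5 — graded budget of the wreath product** (CKSU 2005 Lemma 7.2, graded, elementary
proof): for a subgroup `N ≤ W` of index `I` and `s ≥ 2`, `Σ_{χ ∈ Irr W ∩ J'} χ(1)^s ≤ I^{s-1}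
Σ_{ψ ∈ Irr N ∩ J'_N} ψ(1)^s` whenever every irreducible constituent of every `Res_N χ`,
`χ ∈ Irr W ∩ J'`, lies in `J'_N` (regular character on `W` and on `N` + ℕ-multiplicities of
restrictions: `Σ_χ a_{χψ} χ(1) = I ψ(1)`, so `χ(1) ≤ I ψ(1)` for constituents;
`wreathBudget_index_le`); here `W = (ι → H) ⋊ Perm ι`, `N = H^ι` (via `inl`), `I = |ι|!`,
`J'_N = J_H^{⊠ι}` (slices of `J_wr` at the identity permutation; constituents stay inside because
`J_H^{⊠ι}` is translation invariant — isotypic projectors are averages of translates).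
[cite: CohnKleinbergSzegedyUmans2005, Lemma 7.2] -/
theorem stub_wreathBudget {H : Type} [Group H] [Fintype H] [DecidableEq H] {ι : Type} [Fintype ι]
    [DecidableEq ι] (JH : Submodule ℂ (H → ℂ))
    (hJH : ∀ f ∈ JH, ∀ a b : H, (fun g : H => f (a * g * b)) ∈ JH) (s : ℝ) (hs : 2 ≤ s) :
    (∑ᶠ χ ∈ irrChars ((ι → H) ⋊[mulAutArrow] Equiv.Perm ι) ∩
        (Submodule.span ℂ {F : ((ι → H) ⋊[mulAutArrow] Equiv.Perm ι) → ℂ |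
          ∃ (τ₀ : Equiv.Perm ι) (g : ι → (H → ℂ)), (∀ j, g j ∈ JH) ∧
            F = fun w => if w.right = τ₀ then ∏ j, g j (w.left j) else 0} :
          Set (((ι → H) ⋊[mulAutArrow] Equiv.Perm ι) → ℂ)), (χ 1).re ^ s) ≤
      ((Fintype.card ι).factorial : ℝ) ^ (s - 1) *
        (∑ᶠ χ ∈ irrChars (ι → H) ∩ (Submodule.span ℂ {F : (ι → H) → ℂ | ∃ g : ι → (H → ℂ),
          (∀ k, g k ∈ JH) ∧ F = fun h => ∏ k, g k (h k)} : Set ((ι → H) → ℂ)), (χ 1).re ^ s) := by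
  set Jwr := Submodule.span ℂ {F : ((ι → H) ⋊[mulAutArrow] Equiv.Perm ι) → ℂ |
    ∃ (τ₀ : Equiv.Perm ι) (g : ι → (H → ℂ)), (∀ j, g j ∈ JH) ∧
      F = fun w => if w.right = τ₀ then ∏ j, g j (w.left j) else 0} with hJwr
  set JN := Submodule.span ℂ {F : (ι → H) → ℂ | ∃ g : ι → (H → ℂ),
    (∀ k, g k ∈ JH) ∧ F = fun h => ∏ k, g k (h k)} with hJN
  haveI : Finite ((ι → H) ⋊[mulAutArrow] Equiv.Perm ι) :=
    Finite.of_equiv _ SemidirectProduct.equivProd.symm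
  -- constituents of restrictions of characters in `J_wr` lie in `J_N`
  have hT : ∀ χ ∈ irrChars ((ι → H) ⋊[mulAutArrow] Equiv.Perm ι) ∩
      (Jwr : Set (((ι → H) ⋊[mulAutArrow] Equiv.Perm ι) → ℂ)), ∀ ψ ∈ irrChars (ι → H),
      classInner (fun n => χ (SemidirectProduct.inl n)) ψ ≠ 0 → ψ ∈ (JN : Set ((ι → H) → ℂ)) := by
    rintro χ ⟨hχ, hχJ⟩ ψ hψ hne
    have hres : (fun n : ι → H => χ (SemidirectProduct.inl n)) ∈ JN :=
      wreathBudget_comp_inl_mem JH hχJ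
    have hcl : IsClassFun (fun n : ι → H => χ (SemidirectProduct.inl n)) := by
      intro a b
      have h := (show IsIrrChar _ χ from hχ).isCharacter.isClassFun (SemidirectProduct.inl a)
        (SemidirectProduct.inl b)
      simpa only [map_mul, map_inv] using h
    exact wreathBudget_mem_of_classInner_ne_zero JN
      (fun f hf c => wreathBudget_prodSpace_rightInv JH hJH hf c) hres hcl hψ hne
  have key := wreathBudget_index_le (SemidirectProduct.inl :
      (ι → H) →* (ι → H) ⋊[mulAutArrow] Equiv.Perm ι) SemidirectProduct.inl_injective _ _ hT s hs
  -- the index is `|ι|!`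
  have hI : ((Nat.card ((ι → H) ⋊[mulAutArrow] Equiv.Perm ι) : ℝ) / Nat.card (ι → H)) =
      ((Fintype.card ι).factorial : ℝ) := by
    rw [SemidirectProduct.card, Nat.card_perm, Nat.card_eq_fintype_card (α := ι), Nat.cast_mul,
      mul_div_cancel_left₀]
    exact Nat.cast_ne_zero.mpr Nat.card_pos.ne'
  rw [hI] at key
  exact key

end Summit.MatrixMultiplication.MatrixMultiplication.Theorems.GradedDesignFamily

end
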